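import Literature.MathematicalPhysics.QuantumFieldTheory.Balaban1983to89.Node00.Record13LettersOfThm1CCMWZ
import Summits.QuantumFields.YangMills.Theorems.BalabanUVNodesN11K0DoorAtCRLetteredNumerics
import Summits.QuantumFields.YangMills.Theorems.BalabanUVNodesN11BgRowGaugeSocketsOfPowM

/-!
# DAG node N11 × K0 — THE cR-LETTERED MEMBER AT DEF-1's Z FAMILY, K0 SIDE: the cR-reading letters of the row-`bg` engine, the guarded row P11 and K0⁷'s DOOR PROVISOS at
# `θ₁₃ᶻ(n_c, ε₂₉; Efl, logz) = theta13LiveOfNumericsZ F N n_c ε₂₉ ζ Rz Zt Efl logz`, `n_c := {θ₁₅ᶜᶜᴹᵂ(j; γ)'s numerics with s2.cR := c}`, `0 < c ≤ 8` — this seat's g4 p620936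
# §1–§3 RE-ISSUED BY TOKEN-PASS (№218 (3)) over n11-w5 g3's A2ʷ-Z letters

HEADER — WORK-UNIT METADATA.  Cell `pub-ymgap`, YM-PLAN Track A (HUMAN RULING D-0062 ∕ D-0149 width seats), seat `pub-ymgap-dag-n11-w3` (g5; WIDTH SEAT 3∕4 on NODE n11 [B14]),
route `BalabanUVNodes` rev 29, item K1⁹ `StabilityBRunRowsAtRecordR13SepCoPHV` = stmt-QuantumFields-27364 (helper lane `--kind proof --supports 27364 --as helper`, count-neutral) ·
FLAG №9 z-witness re-key (director-ym №218 (3)).  [III] = [Balaban1988Convergent], [15] = [Balaban1985Variational], [I] = [Balaban1987RG1], [IV] = [Balaban1989LargeFieldI],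
[6] = [Balaban1985RegularSpaces], [LF-II] = [Balaban1989LargeFieldII].  Over DEF-1 g9 Z2 `Node00/Record13NumericsOfThm1CCMZ` (`theta13LiveOfNumericsZ`, `theta13OfNumericsZ`,
`hasResidualsOfRecord_theta13OfNumericsZ`, `admissible_theta13OfNumericsZ`), n11-w5 g3 A2ʷ-Z `Node00/Record13LettersOfThm1CCMWZ` (p641475: `theta13OfThm1CCMWZ_cR ∕ _A₀ ∕ _p₀`,
`lfOfRecord₁₂_theta13OfThm1CCMWZ`, `hpq_theta13OfThm1CCMWZ`), dag-n21-c's θ-GENERIC engines (`Stage13Params.bg_numerics_of_letters`, `gaugeLetter_of_numerics`,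
`Stage13Params.bgAtDatumCoP_of_thm1RegSepCoP7M_of_thm1GaugeR_allTorus`, `Stage13Params.hcompBoth_of_betaBoxSignFree`), K0a's `Stage13Params.provisos₁₃SepCoP_liveRepin₁₃_of_bgSepCoP`,
and this seat's g4 p620936 (`eight_mul_A0OfThm1CC1_le` reused, NOT re-declared).

WHY THIS FILE.  The K1 door re-keys to DEF-1's z-witness `theta13OfThm1CCMWZ … Efl logz` (FLAG №9), where LOCATED-cR persists verbatim (`theta13OfThm1CCMWZ_cR = 1`).  g4's p620936
made K0⁷'s door letters FREE at the cR-lettered W-member for `0 < c ≤ 8`; this file is its token-pass to the z-member, so that K0⁷'s door provisos at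
`ofHistoryBlind ⟨θ₁₃ᶻ(n_c, ε₂₉; Efl, logz), ZrOfRecord₁₃ …⟩` follow from Part 14 §0c's letters AT THE z-WITNESS ((8), the (9)-step, the sign-free β-box of
`betaOfRecord₁₃ F N θ₁₅ᶜᶜᴹᵂᶻ(j; γ; Efl, logz)`) plus ONLY `0 < c ≤ 8` — the key of the guard-free bg road at the cR-lettered z-member (dag-n11-w5's (a)∕(b) and this seat's g5 chain
re-key there by the same token pass).  Proofs = p620936's VERBATIM under «`theta13LiveOfNumerics … Zt ↦ theta13LiveOfNumericsZ … Zt Efl logz`,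
`theta13OfThm1CCMW … a₁ ↦ theta13OfThm1CCMWZ … a₁ Efl logz`, A2ʷ names `…CCMW ↦ …CCMWZ`», except: (hcomp) ∧ (hcompRev) from the β-box now by dag-n21-c's θ-generic
`Stage13Params.hcompBoth_of_betaBoxSignFree` at the z-member directly (no Dʷ-Z twin needed), and the door via K0a's generic socket on `theta13OfNumericsZ`.

WHAT THIS FILE PROVES (15 theorems, 0 `def`, 0 `sorry`; standard axioms).
§1 `hnum_ccmwCRZ` (`0 < c ≤ 8`) · `εreg_le_ccmwCRZ` · `lfOfRecord₁₂_ccmwCRZ` · `hpq_ccmwCRZ` · `hg_ccmwCRZ` · `hC1_ccmwCRZ` · `hBα_ccmwCRZ` (`c ≤ 12`) · `htI_ccmwCRZ` ∕ `htMS_ccmwCRZ` (`c ≤ 192`) ·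
   ★ `hcompBoth_ccmwCRZ_of_betaBoxSignFree` (p620936's rescaling lemmas `hcomp(Rev)_…_of_ccmw` are NOT re-issued — superseded by the generic β-box route).
§2 ★★★ `bgSepCoPAt_ccmwCRZ_of_thm1GaugeR_of_hcomp_allTorus` (the (7)-guarded separated row P11 at the z-member, every family, guard displayed).
§3 ★★★ `provisos₁₃SepCoP_ccmwCRZ_of_thm1GaugeR_of_hcomp_allTorus` · ★★★★ `provisos₁₃SepCoPH_door_ccmwCRZ_of_gauge9TopStepR_of_betaBoxSignFree_allTorus` (K0⁷'s door provisos at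
   the z-member's history-blind door from Part 14 §0c's letters at the z-witness + `0 < c ≤ 8`).
§4 ★★★ `bgProvisoΛ_ccmwCRZ_of_thm1GaugeR_of_hcomp_of_hjm` · ★★★ `bgFacts_ccmwCRZH_of_thm1GaugeR_of_hcomp_of_hjm` — the GUARD-FREE row P11 ∕ the `hbgs` binder at the z-member
   (dag-n11-w5's witness-agnostic socket p638031 on §1's letters; typed here on dag-n11-w5 g3's word I.≈39760).

HONEST FRAMING ∕ A6.  Helper lane, count-neutral token-pass of LANDED kernel bookkeeping of this seat's lineage (elementary real arithmetic on displayed numerals + applications BY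
NAME of θ-generic engines); nothing of Bałaban ([III] ∕ [15] ∕ [6] ∕ [I]) is asserted: (8), the (9)-step ∕ R gauge sentence, (hcomp) ∧ (hcompRev) ∕ the β-box are DISPLAYED
HYPOTHESES (K0⁷'s stub territory), the run guard `PartCompat₁₃` is DISPLAYED in §2∕§3 exactly as in p620936; NO value of `E_k ∕ log z_k` pinned or read; NOT a claim that the z-member
is K1⁹'s witness; FLAG №9 NOT closed by this; NOT a re-pin (no `def`).  K0⁷ NOT closed; N11 NOT discharged; K1⁹ NOT closed, no stub touched; counts unmoved (typed 28∕28 · discharged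
5∕27 · A 5∕28).  One finite `𝕋⁴_{L^K}` programme at fixed `ε = L^{−K}`; `route-QuantumFields-BalabanUVNodes` closes ONLY the CONDITIONAL finite-𝕋⁴ rung `BalabanLadder.UV` — NOT ℝ⁴,
NOT OS, NOT the Yang–Mills mass gap (Clay).  No `sorry`, no `axiom`, no `def`, no `instance`, no `notation`.
Sources (SHAPE only): [III] Thm 1 p.262, (1.15) p.249, (2.1) p.254, (2.4)–(2.8) pp.255–256, (2.10) p.256, (2.12)–(2.13) pp.256–257, (2.18) p.257, (2.25)–(2.28) pp.258–259,
(2.34)–(2.41) p.261, (3.16)–(3.23) pp.268–270; [15] (6)–(7) p.278, Thm 1 (8)–(9) p.279, (144)–(152) pp.300–301, Prop. 8 p.304; [6] (1.3)–(1.9) p.77; [I] Thm 1 p.259, (0.20)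
p.256, (1.12) p.262, (1.20)–(1.22) p.264; [IV] (0.2)–(0.4) p.176; [LF-II] (1.4) p.357, (0.15) p.360.
-/

noncomputable section

open MeasureTheory
open scoped Matrix.Norms.L2Operator

namespace Summit.QuantumFields.YangMills.Theorems.BalabanUVNodesN11K0DoorAtCRLetteredNumericsZ

open Literature.MathematicalPhysics.QuantumFieldTheory.Balaban1983to89 Node00
open T4Continuum B14.Eq218Concrete B15DeterminingSets FlowStep FlowStepRuns B12RegularSpaces111 B14RegularSpaces234
open BalabanUVNodesN11K0DoorAtCRLetteredNumerics (eight_mul_A0OfThm1CC1_le)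

variable {F : T4Family} {N : ℕ} [NeZero N] {j c₁₅ : ℕ} {γ c ε₀ ε₂₉ B₃ B₃' a₀ a₁ : ℝ} {Efl logz : B12.RunParams → ℕ → ℝ} {θ : Stage13Params F N}

/-! ## §1  The cR-reading letters of the row-`bg` engine AT THE z-MEMBER (`A₀ = A₀ᶜᶜ¹` unchanged; the slack of `A₀ᶜ = A₀∕8`) — token-pass of p620936 §1 -/

section Letters

/-- **(hnum) AT THE z-MEMBER** for `0 < c ≤ 8` along every windowed run (`γ ≤ ½`): `0 < c·ε_m`, `c·ε_m ≤ a₁`, `B₃·(c·ε_m) ≤ εreg = a₀` (`ε_m ≤ A₀ᶜᶜ¹`, the slack of `A₀ᶜ = A₀∕8`).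
[cite: Balaban1988Convergent, (2.4) p.255, (2.10) p.256, (2.12) p.256; Balaban1985Variational, (7) p.278, Thm 1 (8) p.279] -/
theorem hnum_ccmwCRZ (hθ : θ = theta13LiveOfNumericsZ F N
      ({ stage12NumericsOfThm1CCMW F.L j γ ε₀ B₃ B₃' a₀ a₁ with s2 := { sect2NumericsOfThm1C F.L with cR := c } } : Stage12Numerics) ε₂₉
      (zeta316OfRecord F N (stage12NumericsOfThm1CCMW F.L j γ ε₀ B₃ B₃' a₀ a₁).ν (stage12NumericsOfThm1CCMW F.L j γ ε₀ B₃ B₃' a₀ a₁).τ9.M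
        (stage12NumericsOfThm1CCMW F.L j γ ε₀ B₃ B₃' a₀ a₁).A₁) (RzOfRecord F N) (ZtOfRecord F N) Efl logz) (hc0 : 0 < c) (hc8 : c ≤ 8) (hγ : γ ≤ 1 / 2) (hB : 0 ≤ B₃) (hB' : 0 ≤ B₃') (ha₀ : 0 < a₀) (ha₁ : 0 < a₁) :
    ∀ (p : B12.RunParams) (n : ℕ), n ≤ p.K → Step.InInterval θ.γ n (gOfRecord₁₃ F N θ p) → ∀ m, m ≤ n →
      0 < θ.s2.cR * epsOfRecord θ.ν (gOfRecord₁₃ F N θ p) m ∧ θ.s2.cR * epsOfRecord θ.ν (gOfRecord₁₃ F N θ p) m ≤ a₁ ∧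
        B₃ * (θ.s2.cR * epsOfRecord θ.ν (gOfRecord₁₃ F N θ p) m) ≤ θ.ν.εreg := by
  subst hθ
  intro p n _ hw m hm
  have hA0 : 0 ≤ A0OfThm1CC1 F.L B₃ B₃' a₀ a₁ := A0OfThm1CC1_nonneg hB hB' ha₀.le ha₁.le
  have hApos : 0 < A0OfThm1CC1 F.L B₃ B₃' a₀ a₁ := A0OfThm1CC1_pos hB hB' ha₀ ha₁
  obtain ⟨h8a, h8b⟩ := eight_mul_A0OfThm1CC1_le (L := F.L) hB hB' ha₀.le ha₁.le
  have hle := epsOfRecord_le_A₀_of_p₀_eq_one (numerics7OfThm1CCM F.L j ε₀ B₃ B₃' a₀ a₁) rfl hA0 (hw m hm).1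
  have hpos := epsOfRecord_pos (numerics7OfThm1CCM F.L j ε₀ B₃ B₃' a₀ a₁) hApos (hw m hm).1 ((hw m hm).2.trans_lt (hγ.trans_lt (by norm_num)))
  change 0 < c * epsOfRecord (numerics7OfThm1CCM F.L j ε₀ B₃ B₃' a₀ a₁) _ m ∧ c * epsOfRecord (numerics7OfThm1CCM F.L j ε₀ B₃ B₃' a₀ a₁) _ m ≤ a₁ ∧
    B₃ * (c * epsOfRecord (numerics7OfThm1CCM F.L j ε₀ B₃ B₃' a₀ a₁) _ m) ≤ a₀
  change epsOfRecord (numerics7OfThm1CCM F.L j ε₀ B₃ B₃' a₀ a₁) _ m ≤ A0OfThm1CC1 F.L B₃ B₃' a₀ a₁ at hle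
  refine ⟨mul_pos hc0 hpos, ?_, ?_⟩
  · nlinarith
  · nlinarith [mul_le_mul_of_nonneg_left hle hB]

/-- `θ.ν.εreg ≤ a₀` at the z-member (it IS `a₀`). [cite: Balaban1985Variational, Thm 1 (8) p.279 (bookkeeping)] -/
theorem εreg_le_ccmwCRZ (hθ : θ = theta13LiveOfNumericsZ F N
      ({ stage12NumericsOfThm1CCMW F.L j γ ε₀ B₃ B₃' a₀ a₁ with s2 := { sect2NumericsOfThm1C F.L with cR := c } } : Stage12Numerics) ε₂₉
      (zeta316OfRecord F N (stage12NumericsOfThm1CCMW F.L j γ ε₀ B₃ B₃' a₀ a₁).ν (stage12NumericsOfThm1CCMW F.L j γ ε₀ B₃ B₃' a₀ a₁).τ9.M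
        (stage12NumericsOfThm1CCMW F.L j γ ε₀ B₃ B₃' a₀ a₁).A₁) (RzOfRecord F N) (ZtOfRecord F N) Efl logz) : θ.ν.εreg ≤ a₀ := by subst hθ; exact le_rfl

/-- The term-constant view `lfOfRecord₁₂` of the member IS that of `θ₁₅ᶜᶜᴹᵂᶻ(j; γ; Efl, logz)` (`rfl`; `c`-blind). [cite: Balaban1988Convergent, (2.28) p.259 (bookkeeping)] -/
theorem lfOfRecord₁₂_ccmwCRZ (hθ : θ = theta13LiveOfNumericsZ F N
      ({ stage12NumericsOfThm1CCMW F.L j γ ε₀ B₃ B₃' a₀ a₁ with s2 := { sect2NumericsOfThm1C F.L with cR := c } } : Stage12Numerics) ε₂₉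
      (zeta316OfRecord F N (stage12NumericsOfThm1CCMW F.L j γ ε₀ B₃ B₃' a₀ a₁).ν (stage12NumericsOfThm1CCMW F.L j γ ε₀ B₃ B₃' a₀ a₁).τ9.M
        (stage12NumericsOfThm1CCMW F.L j γ ε₀ B₃ B₃' a₀ a₁).A₁) (RzOfRecord F N) (ZtOfRecord F N) Efl logz) :
    lfOfRecord₁₂ F N θ.toStage12Params = lfOfRecord₁₂ F N (theta13OfThm1CCMWZ F N j γ ε₀ ε₂₉ B₃ B₃' a₀ a₁ Efl logz).toStage12Params := by subst hθ; rfl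

/-- **`p₀ ≤ q₀` AT THE z-MEMBER** (`1 ≤ 2`; `c`-blind). [cite: Balaban1988Convergent, (2.4) p.255, (2.28) p.259 (bookkeeping)] -/
theorem hpq_ccmwCRZ (hθ : θ = theta13LiveOfNumericsZ F N
      ({ stage12NumericsOfThm1CCMW F.L j γ ε₀ B₃ B₃' a₀ a₁ with s2 := { sect2NumericsOfThm1C F.L with cR := c } } : Stage12Numerics) ε₂₉
      (zeta316OfRecord F N (stage12NumericsOfThm1CCMW F.L j γ ε₀ B₃ B₃' a₀ a₁).ν (stage12NumericsOfThm1CCMW F.L j γ ε₀ B₃ B₃' a₀ a₁).τ9.M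
        (stage12NumericsOfThm1CCMW F.L j γ ε₀ B₃ B₃' a₀ a₁).A₁) (RzOfRecord F N) (ZtOfRecord F N) Efl logz) : θ.ν.p₀ ≤ (lfOfRecord₁₂ F N θ.toStage12Params).q₀ := by
  rw [lfOfRecord₁₂_ccmwCRZ hθ]; subst hθ
  exact hpq_theta13OfThm1CCMWZ (F := F) (N := N) (j := j) (γ := γ) (ε₀ := ε₀) (ε₂₉ := ε₂₉) (B₃ := B₃) (B₃' := B₃') (a₀ := a₀) (a₁ := a₁) (Efl := Efl) (logz := logz)

/-- **THE WINDOW LETTERS AT THE z-MEMBER** (`0 < g_m`, `g_m² ≤ e⁻¹`; `c`-blind — the generated couplings are `θ₁₅ᶜᶜᴹᵂᶻ`'s by `rfl`). [cite: Balaban1987RG1, Thm 1 p.259; Balaban1988Convergent, (2.4) p.255 (bookkeeping)] -/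
theorem hg_ccmwCRZ (hθ : θ = theta13LiveOfNumericsZ F N
      ({ stage12NumericsOfThm1CCMW F.L j γ ε₀ B₃ B₃' a₀ a₁ with s2 := { sect2NumericsOfThm1C F.L with cR := c } } : Stage12Numerics) ε₂₉
      (zeta316OfRecord F N (stage12NumericsOfThm1CCMW F.L j γ ε₀ B₃ B₃' a₀ a₁).ν (stage12NumericsOfThm1CCMW F.L j γ ε₀ B₃ B₃' a₀ a₁).τ9.M
        (stage12NumericsOfThm1CCMW F.L j γ ε₀ B₃ B₃' a₀ a₁).A₁) (RzOfRecord F N) (ZtOfRecord F N) Efl logz) (hγ : γ ≤ 1 / 2) :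
    ∀ (p : B12.RunParams) (n : ℕ), n ≤ p.K → Step.InInterval θ.γ n (gOfRecord₁₃ F N θ p) → ∀ m, m ≤ n →
      0 < gOfRecord₁₃ F N θ p m ∧ gOfRecord₁₃ F N θ p m ^ 2 ≤ Real.exp (-1) := by
  subst hθ
  exact fun _ _ _ hw => window_sq_le_of_inInterval hγ hw

/-- **(C1) NESTED GRIDS AT THE z-MEMBER** (`R_m = L·t_m`; `c`-blind). [cite: Balaban1988Convergent, (2.5) p.255, p.257] -/
theorem hC1_ccmwCRZ (hθ : θ = theta13LiveOfNumericsZ F N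
      ({ stage12NumericsOfThm1CCMW F.L j γ ε₀ B₃ B₃' a₀ a₁ with s2 := { sect2NumericsOfThm1C F.L with cR := c } } : Stage12Numerics) ε₂₉
      (zeta316OfRecord F N (stage12NumericsOfThm1CCMW F.L j γ ε₀ B₃ B₃' a₀ a₁).ν (stage12NumericsOfThm1CCMW F.L j γ ε₀ B₃ B₃' a₀ a₁).τ9.M
        (stage12NumericsOfThm1CCMW F.L j γ ε₀ B₃ B₃' a₀ a₁).A₁) (RzOfRecord F N) (ZtOfRecord F N) Efl logz) (hγ : γ ≤ 1 / 2) :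
    ∀ (p : B12.RunParams) (n : ℕ), n ≤ p.K → Step.InInterval θ.γ n (gOfRecord₁₃ F N θ p) → ∀ m, 1 ≤ m → m ≤ n →
      ∃ t : ℕ, 0 < t ∧ RkOfRecord (F.P p.K).L θ.ν.r (gOfRecord₁₃ F N θ p m) = (F.P p.K).L * t := by
  subst hθ
  intro p n _ hw m _ hm
  have hL : 2 ≤ (F.P p.K).L := by show 2 ≤ F.L; have := F.hL11; omega
  exact exists_RkOfRecord_eq_mul hL (le_of_eq (rfl : (1 : ℕ) = _)) (one_lt_log_inv_sq_of_le_half (hw m hm).1 ((hw m hm).2.trans hγ))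

/-- **(hBα) AT THE z-MEMBER** for `0 ≤ c ≤ 12` (`bg_numerics_of_letters`: `p₀ ≤ q₀`, `B₃·c·A₀ᶜᶜ¹ ≤ 12∕16 = ¾ = (1 − ¼)·C₀`, the window letters).
[cite: Balaban1988Convergent, (2.4) p.255, (2.28) p.259, (2.34) p.261] -/
theorem hBα_ccmwCRZ (hθ : θ = theta13LiveOfNumericsZ F N
      ({ stage12NumericsOfThm1CCMW F.L j γ ε₀ B₃ B₃' a₀ a₁ with s2 := { sect2NumericsOfThm1C F.L with cR := c } } : Stage12Numerics) ε₂₉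
      (zeta316OfRecord F N (stage12NumericsOfThm1CCMW F.L j γ ε₀ B₃ B₃' a₀ a₁).ν (stage12NumericsOfThm1CCMW F.L j γ ε₀ B₃ B₃' a₀ a₁).τ9.M
        (stage12NumericsOfThm1CCMW F.L j γ ε₀ B₃ B₃' a₀ a₁).A₁) (RzOfRecord F N) (ZtOfRecord F N) Efl logz) (hc0 : 0 ≤ c) (hc12 : c ≤ 12) (hγ : γ ≤ 1 / 2) (hB : 0 ≤ B₃) (hB' : 0 ≤ B₃') (ha₀ : 0 ≤ a₀) (ha₁ : 0 ≤ a₁) :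
    ∀ (p : B12.RunParams) (n : ℕ), n ≤ p.K → Step.InInterval θ.γ n (gOfRecord₁₃ F N θ p) → ∀ m, 1 ≤ m → m ≤ n →
      B₃ * (θ.s2.cR * epsOfRecord θ.ν (gOfRecord₁₃ F N θ p) m) ≤ (1 - θ.s2.βc) * (lfOfRecord₁₂ F N θ.toStage12Params).alpha0 (gOfRecord₁₃ F N θ p m) := by
  have hpq := hpq_ccmwCRZ hθ
  have hlf := lfOfRecord₁₂_ccmwCRZ hθ
  have hg := hg_ccmwCRZ hθ hγ
  subst hθ
  intro p n hn hw
  have hA0 : 0 ≤ A0OfThm1CC1 F.L B₃ B₃' a₀ a₁ := A0OfThm1CC1_nonneg hB hB' ha₀ ha₁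
  have h16 := mul_A0OfThm1CC1_le (L := F.L) hB hB' ha₀ ha₁
  refine Stage13Params.bg_numerics_of_letters _ hpq ?_ ?_ p n (hg p n hn hw)
  · change 0 ≤ B₃ * c * A0OfThm1CC1 F.L B₃ B₃' a₀ a₁
    positivity
  · rw [hlf, lfOfRecord₁₂_theta13OfThm1CCMWZ]
    change B₃ * c * A0OfThm1CC1 F.L B₃ B₃' a₀ a₁ ≤ (1 - 1 / 4) * _
    norm_num [lfConstsOfFamily, lfConstsOfRecord₁₂]
    nlinarith

/-- **★ THE I-FAMILY RADIUS LETTER (htI) AT THE z-MEMBER** for `0 ≤ c ≤ 192` (`gaugeLetter_of_numerics`: `B₃′·c·A₀ᶜᶜ¹ ≤ 1 ≤ c_B·C₀`, `B₃′·A₀ᶜᶜ¹ ≤ 1∕192`).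
[cite: Balaban1987RG1, (1.12) p.262; Balaban1988Convergent, (2.4) p.255, (2.28) p.259] -/
theorem htI_ccmwCRZ (hθ : θ = theta13LiveOfNumericsZ F N
      ({ stage12NumericsOfThm1CCMW F.L j γ ε₀ B₃ B₃' a₀ a₁ with s2 := { sect2NumericsOfThm1C F.L with cR := c } } : Stage12Numerics) ε₂₉
      (zeta316OfRecord F N (stage12NumericsOfThm1CCMW F.L j γ ε₀ B₃ B₃' a₀ a₁).ν (stage12NumericsOfThm1CCMW F.L j γ ε₀ B₃ B₃' a₀ a₁).τ9.M
        (stage12NumericsOfThm1CCMW F.L j γ ε₀ B₃ B₃' a₀ a₁).A₁) (RzOfRecord F N) (ZtOfRecord F N) Efl logz) (hc0 : 0 ≤ c) (hc : c ≤ 192) (hγ : γ ≤ 1 / 2) (hB : 0 ≤ B₃) (hB' : 0 ≤ B₃') (ha₀ : 0 ≤ a₀) (ha₁ : 0 ≤ a₁) :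
    ∀ (p : B12.RunParams) (n : ℕ), n ≤ p.K → Step.InInterval θ.γ n (gOfRecord₁₃ F N θ p) → ∀ m, 1 ≤ m → m ≤ n →
      B₃' * (θ.s2.cR * epsOfRecord θ.ν (gOfRecord₁₃ F N θ p) m) ≤ θ.s2.cB * (lfOfRecord₁₂ F N θ.toStage12Params).alpha0 (gOfRecord₁₃ F N θ p m) := by
  have hpq := hpq_ccmwCRZ hθ
  have hlf := lfOfRecord₁₂_ccmwCRZ hθ
  have hg := hg_ccmwCRZ hθ hγ
  subst hθ
  intro p n hn hw
  have hA0 : 0 ≤ A0OfThm1CC1 F.L B₃ B₃' a₀ a₁ := A0OfThm1CC1_nonneg hB hB' ha₀ ha₁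
  have h192 := gauge_mul_A0OfThm1CC1_le (L := F.L) F.hL.2.le hB hB' ha₀ ha₁
  have hL1 : (1 : ℝ) ≤ F.L := by exact_mod_cast F.hL.2.le
  refine gaugeLetter_of_numerics _ _ (fun m _ hm => hg p n hn hw m hm) hpq ?_ ?_
  · change 0 ≤ B₃' * c * A0OfThm1CC1 F.L B₃ B₃' a₀ a₁
    positivity
  · rw [hlf, lfOfRecord₁₂_theta13OfThm1CCMWZ]
    change B₃' * c * A0OfThm1CC1 F.L B₃ B₃' a₀ a₁ ≤ (6 * (F.L : ℝ) + 1) * _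
    norm_num [lfConstsOfFamily, lfConstsOfRecord₁₂]
    nlinarith

/-- **★ THE MS-FAMILY RADIUS LETTER (htMS) AT THE z-MEMBER** for `0 ≤ c ≤ 192` (`B₃′·c·A₀ᶜᶜ¹ ≤ 1 ≤ 7 = B·C·M_r·C₀`). [cite: Balaban1988Convergent, (2.38) p.261, (2.4) p.255, (2.28) p.259] -/
theorem htMS_ccmwCRZ (hθ : θ = theta13LiveOfNumericsZ F N
      ({ stage12NumericsOfThm1CCMW F.L j γ ε₀ B₃ B₃' a₀ a₁ with s2 := { sect2NumericsOfThm1C F.L with cR := c } } : Stage12Numerics) ε₂₉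
      (zeta316OfRecord F N (stage12NumericsOfThm1CCMW F.L j γ ε₀ B₃ B₃' a₀ a₁).ν (stage12NumericsOfThm1CCMW F.L j γ ε₀ B₃ B₃' a₀ a₁).τ9.M
        (stage12NumericsOfThm1CCMW F.L j γ ε₀ B₃ B₃' a₀ a₁).A₁) (RzOfRecord F N) (ZtOfRecord F N) Efl logz) (hc0 : 0 ≤ c) (hc : c ≤ 192) (hγ : γ ≤ 1 / 2) (hB : 0 ≤ B₃) (hB' : 0 ≤ B₃') (ha₀ : 0 ≤ a₀) (ha₁ : 0 ≤ a₁) :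
    ∀ (p : B12.RunParams) (n : ℕ), n ≤ p.K → Step.InInterval θ.γ n (gOfRecord₁₃ F N θ p) → ∀ m, 1 ≤ m → m ≤ n →
      B₃' * (θ.s2.cR * epsOfRecord θ.ν (gOfRecord₁₃ F N θ p) m) ≤ θ.s2.B * θ.s2.C * θ.s2.Mr * (lfOfRecord₁₂ F N θ.toStage12Params).alpha0 (gOfRecord₁₃ F N θ p m) := by
  have hpq := hpq_ccmwCRZ hθ
  have hlf := lfOfRecord₁₂_ccmwCRZ hθ
  have hg := hg_ccmwCRZ hθ hγ
  subst hθ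
  intro p n hn hw
  have hA0 : 0 ≤ A0OfThm1CC1 F.L B₃ B₃' a₀ a₁ := A0OfThm1CC1_nonneg hB hB' ha₀ ha₁
  have h192 := gauge_mul_A0OfThm1CC1_le (L := F.L) F.hL.2.le hB hB' ha₀ ha₁
  refine gaugeLetter_of_numerics _ _ (fun m _ hm => hg p n hn hw m hm) hpq ?_ ?_
  · change 0 ≤ B₃' * c * A0OfThm1CC1 F.L B₃ B₃' a₀ a₁
    positivity
  · rw [hlf, lfOfRecord₁₂_theta13OfThm1CCMWZ]
    change B₃' * c * A0OfThm1CC1 F.L B₃ B₃' a₀ a₁ ≤ 7 * 1 * 1 * _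
    norm_num [lfConstsOfFamily, lfConstsOfRecord₁₂]
    nlinarith

/-- **★ (hcomp) ∧ (hcompRev) AT THE z-MEMBER FROM THE SIGN-FREE WINDOWED β-BOX OF `betaOfRecord₁₃ F N θ₁₅ᶜᶜᴹᵂᶻ(j; γ; Efl, logz)`** — dag-n21-c's θ-GENERIC
`Stage13Params.hcompBoth_of_betaBoxSignFree` (Dʷ `Record13SignFreeComparabilityOfBetaBox`) applied AT THE z-MEMBER (`A₀ = A₀ᶜᶜ¹ ≥ 0`, `p₀ = 1`, `γ ≤ ½`, `0 ≤ cR = c`); the β of record is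
`c`-blind (`betaOfRecord₁₃_ccmwCRZ`, `rfl`), so the box is stated at the z-witness as Part 14 states it. [cite: Balaban1987RG1, (0.20) p.256, (1.20)–(1.22) p.264; Balaban1988Convergent, (2.6)–(2.8) pp.255–256] -/
theorem hcompBoth_ccmwCRZ_of_betaBoxSignFree (hθ : θ = theta13LiveOfNumericsZ F N
      ({ stage12NumericsOfThm1CCMW F.L j γ ε₀ B₃ B₃' a₀ a₁ with s2 := { sect2NumericsOfThm1C F.L with cR := c } } : Stage12Numerics) ε₂₉
      (zeta316OfRecord F N (stage12NumericsOfThm1CCMW F.L j γ ε₀ B₃ B₃' a₀ a₁).ν (stage12NumericsOfThm1CCMW F.L j γ ε₀ B₃ B₃' a₀ a₁).τ9.M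
        (stage12NumericsOfThm1CCMW F.L j γ ε₀ B₃ B₃' a₀ a₁).A₁) (RzOfRecord F N) (ZtOfRecord F N) Efl logz) (hc0 : 0 ≤ c) (hγ : γ ≤ 1 / 2) (hB : 0 ≤ B₃) (hB' : 0 ≤ B₃') (ha₀ : 0 ≤ a₀) (ha₁ : 0 ≤ a₁)
    {bl β' : ℝ} (hbox : BetaLowerH bl γ (betaOfRecord₁₃ F N (theta13OfThm1CCMWZ F N j γ ε₀ ε₂₉ B₃ B₃' a₀ a₁ Efl logz)))
    (hbox' : BetaUpperH β' γ (betaOfRecord₁₃ F N (theta13OfThm1CCMWZ F N j γ ε₀ ε₂₉ B₃ B₃' a₀ a₁ Efl logz))) (hl : -bl * γ ^ 2 ≤ 3) (hβ' : β' * γ ^ 2 ≤ 3 / 4) :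
    (∀ (p : B12.RunParams) (n : ℕ), n ≤ p.K → Step.InInterval θ.γ n (gOfRecord₁₃ F N θ p) → ∀ m, m < n →
      θ.s2.cR * epsOfRecord θ.ν (gOfRecord₁₃ F N θ p) m ≤ 2 * (θ.s2.cR * epsOfRecord θ.ν (gOfRecord₁₃ F N θ p) (m + 1))) ∧
    (∀ (p : B12.RunParams) (n : ℕ), n ≤ p.K → Step.InInterval θ.γ n (gOfRecord₁₃ F N θ p) → ∀ m, m < n →
      θ.s2.cR * epsOfRecord θ.ν (gOfRecord₁₃ F N θ p) (m + 1) ≤ 2 * (θ.s2.cR * epsOfRecord θ.ν (gOfRecord₁₃ F N θ p) m)) := by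
  subst hθ
  exact Stage13Params.hcompBoth_of_betaBoxSignFree _ (A0OfThm1CC1_nonneg hB hB' ha₀ ha₁) rfl hγ hc0 hbox hbox' hl hβ'

end Letters

/-! ## §2  ★★★ The (7)-guarded separated row P11 at the Co carrier AT THE z-MEMBER, on every family -/

section BgRow

/-- **★★★ THE (7)-GUARDED SEPARATED ROW P11 AT THE Co CARRIER AT THE cR-LETTERED MEMBER FROM `0 < γ ≤ ½`, (8), THE R GAUGE SENTENCE AND (hcomp) ∧ (hcompRev), ON EVERY
FAMILY, for `0 < c ≤ 8`** — dag-n21-c's Eʷ-allTorus §3 (`bgSepCoPAt_theta13OfThm1CCMWZ_of_thm1GaugeR_of_hcomp_allTorus`) RE-RUN AT THE z-MEMBER through the θ-generic engine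
`Stage13Params.bgAtDatumCoP_of_thm1RegSepCoP7M_of_thm1GaugeR_allTorus` with §1's letters (statement = Eʷ's with `θ₁₅ᶜᶜᴹᵂ ↦ θ`).  CONDITIONAL; nothing of Bałaban asserted.
[cite: Balaban1985Variational, (6)–(7) p.278, Thm 1 (8)–(9) p.279, (144)–(152) pp.300–301, Prop. 8 p.304; Balaban1985RegularSpaces, (1.3)–(1.9) p.77; Balaban1988Convergent, Thm 1 p.262, (2.1) p.254, (2.4)–(2.8) pp.255–256, (2.10) p.256, (2.12)–(2.13) pp.256–257, (2.18) p.257, (2.25)–(2.28) pp.258–259; Balaban1987RG1, Thm 1 p.259, (1.12) p.262] -/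
theorem bgSepCoPAt_ccmwCRZ_of_thm1GaugeR_of_hcomp_allTorus (hθ : θ = theta13LiveOfNumericsZ F N
      ({ stage12NumericsOfThm1CCMW F.L j γ ε₀ B₃ B₃' a₀ a₁ with s2 := { sect2NumericsOfThm1C F.L with cR := c } } : Stage12Numerics) ε₂₉
      (zeta316OfRecord F N (stage12NumericsOfThm1CCMW F.L j γ ε₀ B₃ B₃' a₀ a₁).ν (stage12NumericsOfThm1CCMW F.L j γ ε₀ B₃ B₃' a₀ a₁).τ9.M
        (stage12NumericsOfThm1CCMW F.L j γ ε₀ B₃ B₃' a₀ a₁).A₁) (RzOfRecord F N) (ZtOfRecord F N) Efl logz)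
    (hc0 : 0 < c) (hc8 : c ≤ 8) (hγ0 : 0 < γ) (hγ : γ ≤ 1 / 2) (hε : 0 < ε₀) (hε' : 0 < ε₂₉) (hB : 0 ≤ B₃) (hB' : 0 ≤ B₃') (ha₀ : 0 < a₀) (ha₁ : 0 < a₁)
    (h15 : VariationalThm1RegSepCoP7M F N B₃ a₀ a₁) (hc₁₅ : c₁₅ ≤ F.L ^ j) (h15G : VariationalThm1GaugeRegSepCoP7MR F N (F.L ^ j) c₁₅ B₃ B₃' a₀ a₁)
    (hcomp : ∀ (p : B12.RunParams) (n : ℕ), n ≤ p.K → Step.InInterval θ.γ n (gOfRecord₁₃ F N θ p) → ∀ m, m < n →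
      θ.s2.cR * epsOfRecord θ.ν (gOfRecord₁₃ F N θ p) m ≤ 2 * (θ.s2.cR * epsOfRecord θ.ν (gOfRecord₁₃ F N θ p) (m + 1)))
    (hcompRev : ∀ (p : B12.RunParams) (n : ℕ), n ≤ p.K → Step.InInterval θ.γ n (gOfRecord₁₃ F N θ p) → ∀ m, m < n →
      θ.s2.cR * epsOfRecord θ.ν (gOfRecord₁₃ F N θ p) (m + 1) ≤ 2 * (θ.s2.cR * epsOfRecord θ.ν (gOfRecord₁₃ F N θ p) m)) :
    ∀ (p : B12.RunParams) (n : ℕ), n ≤ p.K → Step.InInterval θ.γ n (gOfRecord₁₃ F N θ p) → PartCompat₁₃ F N θ p n →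
      ∀ s : SeqOfRecord F θ.ν θ.τ9.M (gOfRecord₁₃ F N θ p) p.K n, Sect2.SeqSeparated θ.ν.M₁ s →
      ∀ W : MSField (F.P p.K) (SU N), W ∈ suppOfRecord₁₃P F N θ p n s →
      Sect2.DataSmall7PTop (avOfRecord F N p.K) s.Ω (suppDomOfRecord F θ.ν p.K s.Ω) n (fun j' => θ.s2.cR * epsOfRecord θ.ν (gOfRecord₁₃ F N θ p) j') W →
      ∀ j', 1 ≤ j' → j' ≤ n → ∀ X : (Sect2.domSys (F.P p.K) θ.τ9.M j').Dom,
      (Sect2.domSites (F.P p.K) θ.τ9.M j' X ⊆ s.Λ j' →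
        Sect2.ofBackgroundC (settingOfRecord₁₃ F N θ p).ι (UbgOfRecord₁₃CoP F N θ p n s W) ∈
          Sect2.spaceI (settingOfRecord₁₃ F N θ p) (θ.Rz p.K) θ.τ9.M j' (Sect2.domSites (F.P p.K) θ.τ9.M j' X)
            ((settingOfRecord₁₃ F N θ p).lf.alpha0 ((settingOfRecord₁₃ F N θ p).flow.g j')) ((settingOfRecord₁₃ F N θ p).lf.alpha1 ((settingOfRecord₁₃ F N θ p).flow.g j'))) ∧
      (Sect2.admB (F.P p.K) θ.ν θ.τ9.M (gOfRecord₁₃ F N θ p) s.Ω s.Λ j' (Sect2.domSites (F.P p.K) θ.τ9.M j' X) = true →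
        Sect2.ofBackgroundC (settingOfRecord₁₃ F N θ p).ι (UbgOfRecord₁₃CoP F N θ p n s W) ∈
          Sect2.spaceMS (settingOfRecord₁₃ F N θ p) (θ.Rz p.K) θ.τ9.M j' (Sect2.domSites (F.P p.K) θ.τ9.M j' X) s.Ω) := by
  have hnum := hnum_ccmwCRZ hθ hc0 hc8 hγ hB hB' ha₀ ha₁
  have hεreg := εreg_le_ccmwCRZ hθ
  have hBα := hBα_ccmwCRZ hθ hc0.le (by linarith) hγ hB hB' ha₀.le ha₁.le
  have htI := htI_ccmwCRZ hθ hc0.le (by linarith) hγ hB hB' ha₀.le ha₁.le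
  have htMS := htMS_ccmwCRZ hθ hc0.le (by linarith) hγ hB hB' ha₀.le ha₁.le
  have hC1 := hC1_ccmwCRZ hθ hγ
  subst hθ
  have hγ1 : γ < 1 := hγ.trans_lt (by norm_num)
  have hpos : ({ stage12NumericsOfThm1CCMW F.L j γ ε₀ B₃ B₃' a₀ a₁ with s2 := { sect2NumericsOfThm1C F.L with cR := c } } : Stage12Numerics).Pos := by
    obtain ⟨h1, h2, h3, h4, h5, h6, -, h8, h9⟩ := stage12NumericsOfThm1CCMW_pos (j := j) F.hL.2.le hγ0 hγ1 hε hB hB' ha₀ ha₁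
    exact ⟨h1, h2, h3, h4, h5, h6, hc0, h8, h9⟩
  have hadm := (admissible_theta13OfNumericsZ
    (n := ({ stage12NumericsOfThm1CCMW F.L j γ ε₀ B₃ B₃' a₀ a₁ with s2 := { sect2NumericsOfThm1C F.L with cR := c } } : Stage12Numerics)) F N
    (zeta316OfRecord F N (stage12NumericsOfThm1CCMW F.L j γ ε₀ B₃ B₃' a₀ a₁).ν (stage12NumericsOfThm1CCMW F.L j γ ε₀ B₃ B₃' a₀ a₁).τ9.M
      (stage12NumericsOfThm1CCMW F.L j γ ε₀ B₃ B₃' a₀ a₁).A₁) (RzOfRecord F N) (ZtOfRecord F N) Efl logz hpos hε').liveRepin₁₃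
  intro p n hn hw hpc s hsep W _ h7
  cases n with
  | zero => intro j' h1 hj'; exfalso; omega
  | succ n =>
    rw [UbgOfRecord₁₃CoP_succ]
    exact Stage13Params.bgAtDatumCoP_of_thm1RegSepCoP7M_of_thm1GaugeR_allTorus _ hadm rfl
      (show 0 < F.L ^ j from pow_pos (by have := F.hL11; omega) _) (show c₁₅ ≤ F.L ^ j from hc₁₅) h15 h15G hnum hεreg
      hcomp hcompRev hBα htI htMS hC1 ⟨j, rfl⟩ p (n + 1) hn hw hpc s hsep (show 0 < F.L ^ j from pow_pos (by have := F.hL11; omega) _) W h7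

end BgRow

/-! ## §3  ★★★★ K0⁷'s door provisos at the z-member from Part 14 §0c's hypotheses VERBATIM (plus `0 < c ≤ 8`) -/

section Door

/-- **★★★ `Provisos₁₃SepCoP` AT THE z-MEMBER FROM `0 < γ ≤ ½`, (8), THE R GAUGE SENTENCE AND (hcomp) ∧ (hcompRev), ON EVERY FAMILY** — node00-def-K0a's generic socket
DEF-1 ∕ K0as generic `Stage13Params.provisos₁₃SepCoP_liveRepin₁₃_of_bgSepCoP` on `theta13OfNumericsZ` (`hasResidualsOfRecord_theta13OfNumericsZ`) ∘ §2 (`hM := ⟨j, rfl⟩`, `hM₁ := dvd_refl`).  CONDITIONAL; nothing of Bałaban asserted.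
[cite: Balaban1985Variational, Thm 1 (8)–(9) p.279, (152) p.301; Balaban1988Convergent, Thm 1 p.262, (2.7) p.255, (2.12) p.256, (2.28) p.259, (3.16)–(3.22) pp.268–269; Balaban1985RegularSpaces, (1.3)–(1.9) p.77] -/
theorem provisos₁₃SepCoP_ccmwCRZ_of_thm1GaugeR_of_hcomp_allTorus (hθ : θ = theta13LiveOfNumericsZ F N
      ({ stage12NumericsOfThm1CCMW F.L j γ ε₀ B₃ B₃' a₀ a₁ with s2 := { sect2NumericsOfThm1C F.L with cR := c } } : Stage12Numerics) ε₂₉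
      (zeta316OfRecord F N (stage12NumericsOfThm1CCMW F.L j γ ε₀ B₃ B₃' a₀ a₁).ν (stage12NumericsOfThm1CCMW F.L j γ ε₀ B₃ B₃' a₀ a₁).τ9.M
        (stage12NumericsOfThm1CCMW F.L j γ ε₀ B₃ B₃' a₀ a₁).A₁) (RzOfRecord F N) (ZtOfRecord F N) Efl logz)
    (hc0 : 0 < c) (hc8 : c ≤ 8) (hγ0 : 0 < γ) (hγ : γ ≤ 1 / 2) (hε : 0 < ε₀) (hε' : 0 < ε₂₉) (hB : 0 ≤ B₃) (hB' : 0 ≤ B₃') (ha₀ : 0 < a₀) (ha₁ : 0 < a₁)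
    (h15 : VariationalThm1RegSepCoP7M F N B₃ a₀ a₁) (hc₁₅ : c₁₅ ≤ F.L ^ j) (h15G : VariationalThm1GaugeRegSepCoP7MR F N (F.L ^ j) c₁₅ B₃ B₃' a₀ a₁)
    (hcomp : ∀ (p : B12.RunParams) (n : ℕ), n ≤ p.K → Step.InInterval θ.γ n (gOfRecord₁₃ F N θ p) → ∀ m, m < n →
      θ.s2.cR * epsOfRecord θ.ν (gOfRecord₁₃ F N θ p) m ≤ 2 * (θ.s2.cR * epsOfRecord θ.ν (gOfRecord₁₃ F N θ p) (m + 1)))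
    (hcompRev : ∀ (p : B12.RunParams) (n : ℕ), n ≤ p.K → Step.InInterval θ.γ n (gOfRecord₁₃ F N θ p) → ∀ m, m < n →
      θ.s2.cR * epsOfRecord θ.ν (gOfRecord₁₃ F N θ p) (m + 1) ≤ 2 * (θ.s2.cR * epsOfRecord θ.ν (gOfRecord₁₃ F N θ p) m)) :
    θ.Provisos₁₃SepCoP F N := by
  have hbg := bgSepCoPAt_ccmwCRZ_of_thm1GaugeR_of_hcomp_allTorus hθ hc0 hc8 hγ0 hγ hε hε' hB hB' ha₀ ha₁ h15 hc₁₅ h15G hcomp hcompRev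
  subst hθ
  exact (theta13OfNumericsZ F N
    ({ stage12NumericsOfThm1CCMW F.L j γ ε₀ B₃ B₃' a₀ a₁ with s2 := { sect2NumericsOfThm1C F.L with cR := c } } : Stage12Numerics) ε₂₉ _ _ _ Efl logz).provisos₁₃SepCoP_liveRepin₁₃_of_bgSepCoP
    (hasResidualsOfRecord_theta13OfNumericsZ F N _ ε₂₉ Efl logz) ⟨j, rfl⟩ (dvd_refl _) hbg

/-- **★★★★ K0⁷'s DOOR PROVISOS AT THE HISTORY-BLIND DOOR OVER THE CURED cR-LETTERED MEMBER, FROM dag-n24-c PART 14 §0c's HYPOTHESES VERBATIM** (`0 < γ ≤ ½`, the six signs,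
(8) `VariationalThm1RegSepCoP7M F N B₃ a₀ a₁`, the floor `c₁₅ ≤ L^j`, [15] Sect. F's R (9)-step `Gauge9RegSepTopStepR … (F.L ^ j) c₁₅ B₃ B₃' a₀ a₁`, the SIGN-FREE windowed β-box
`BetaLowerH bₗ γ ∕ BetaUpperH β′ γ` OF `betaOfRecord₁₃ F N θ₁₅ᶜᶜᴹᵂᶻ(j; γ; Efl, logz)` with `−bₗ·γ² ≤ 3`, `β′·γ² ≤ ¾`) **PLUS ONLY `0 < c ≤ 8`** — the K0 side of the cR re-pin is FREE.
CONDITIONAL on the displayed sentences (K0⁷'s stub territory); nothing of Bałaban asserted.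
[cite: Balaban1985Variational, Thm 1 (8)–(9) p.279, (144)–(152) pp.300–301, Prop. 8 p.304; Balaban1988Convergent, Thm 1 p.262, (2.6)–(2.8) pp.255–256, (2.10) p.256, (2.21) p.258, (3.16)–(3.23) pp.268–270; Balaban1987RG1, Thm 1 p.259, (0.20) p.256, (1.20)–(1.22) p.264, §1 p.264; Balaban1989LargeFieldI, (0.2)–(0.4) p.176; Balaban1989LargeFieldII, (1.4) p.357] -/
theorem provisos₁₃SepCoPH_door_ccmwCRZ_of_gauge9TopStepR_of_betaBoxSignFree_allTorus (hθ : θ = theta13LiveOfNumericsZ F N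
      ({ stage12NumericsOfThm1CCMW F.L j γ ε₀ B₃ B₃' a₀ a₁ with s2 := { sect2NumericsOfThm1C F.L with cR := c } } : Stage12Numerics) ε₂₉
      (zeta316OfRecord F N (stage12NumericsOfThm1CCMW F.L j γ ε₀ B₃ B₃' a₀ a₁).ν (stage12NumericsOfThm1CCMW F.L j γ ε₀ B₃ B₃' a₀ a₁).τ9.M
        (stage12NumericsOfThm1CCMW F.L j γ ε₀ B₃ B₃' a₀ a₁).A₁) (RzOfRecord F N) (ZtOfRecord F N) Efl logz)
    (hc0 : 0 < c) (hc8 : c ≤ 8) (hγ0 : 0 < γ) (hγ : γ ≤ 1 / 2) (hε : 0 < ε₀) (hε' : 0 < ε₂₉) (hB : 0 ≤ B₃) (hB' : 0 ≤ B₃') (ha₀ : 0 < a₀) (ha₁ : 0 < a₁)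
    (h15 : VariationalThm1RegSepCoP7M F N B₃ a₀ a₁) (hc₁₅ : c₁₅ ≤ F.L ^ j)
    (h9 : Gauge9RegSepTopStepR F N (fun ν K Ω => suppDomOfRecord F ν K Ω) (F.L ^ j) c₁₅ B₃ B₃' a₀ a₁)
    {bl β' : ℝ} (hbox : BetaLowerH bl γ (betaOfRecord₁₃ F N (theta13OfThm1CCMWZ F N j γ ε₀ ε₂₉ B₃ B₃' a₀ a₁ Efl logz)))
    (hbox' : BetaUpperH β' γ (betaOfRecord₁₃ F N (theta13OfThm1CCMWZ F N j γ ε₀ ε₂₉ B₃ B₃' a₀ a₁ Efl logz))) (hl : -bl * γ ^ 2 ≤ 3) (hβ' : β' * γ ^ 2 ≤ 3 / 4) :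
    (Stage13HParams.ofHistoryBlind F N ⟨θ, ZrOfRecord₁₃ F N θ⟩).Provisos₁₃SepCoPH F N :=
  have H := hcompBoth_ccmwCRZ_of_betaBoxSignFree hθ hc0.le hγ hB hB' ha₀.le ha₁.le hbox hbox' hl hβ'
  (provisos₁₃SepCoP_ccmwCRZ_of_thm1GaugeR_of_hcomp_allTorus hθ hc0 hc8 hγ0 hγ hε hε' hB hB' ha₀ ha₁ h15 hc₁₅
    (variationalThm1GaugeRegSepCoP7MR_of_gauge9TopStepR h9) H.1 H.2).ofCured.ofHistoryBlind

end Door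

/-! ## §4  ★★★ The GUARD-FREE row P11 at the z-member (dag-n11-w5 g3's witness-agnostic socket p638031 on §1's letters) and the `hbgs` binder at its H-extensions -/

section GuardFree

open BalabanUVNodesN11BgRowGaugeSocketsOfPowM (bgProvisoΛ_of_thm1GaugeR_of_powM)

/-- **★★★ ROW P11 `bg` IN ITS OWN CURRENCY AT THE cR-LETTERED z-MEMBER ON EVERY WINDOW RUN — NO RUN GUARD** (`0 < c ≤ 8`, `0 < γ ≤ ½`, non-wrapping families `j + 1 ≤ F.m`):
dag-n11-w5 g3's witness-agnostic socket `bgProvisoΛ_of_thm1GaugeR_of_powM` (p638031 §2) at the z-member with §1's letters, `hMa := rfl` (`M = L^j`), `hC1_ccmwCRZ`, and the no-wrap letter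
`hsN_theta13OfThm1CCMWZ … hjm` (A2ʷ-Z; the z-member's `τ9` is the z-witness's, `rfl`) — the z-twin of dag-n11-w5 g2's p629786 §2 (typed here on dag-n11-w5 g3's word, pub-ymgap INBOX
2026-08-28 14:53Z).  CONDITIONAL on (8), (9), (hcomp) ∧ (hcompRev); nothing of Bałaban asserted.
[cite: Balaban1988Convergent, (2.28) p.259, (2.18) p.257, Thm 1 p.262, (2.4)–(2.8) pp.255–256, (2.10) p.256; Balaban1985Variational, (6)–(7) p.278, Thm 1 (8)–(9) p.279; Balaban1985RegularSpaces, (1.3)–(1.6) p.77; Balaban1987RG1, Thm 1 p.259, (1.12) p.262] -/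
theorem bgProvisoΛ_ccmwCRZ_of_thm1GaugeR_of_hcomp_of_hjm (hθ : θ = theta13LiveOfNumericsZ F N
      ({ stage12NumericsOfThm1CCMW F.L j γ ε₀ B₃ B₃' a₀ a₁ with s2 := { sect2NumericsOfThm1C F.L with cR := c } } : Stage12Numerics) ε₂₉
      (zeta316OfRecord F N (stage12NumericsOfThm1CCMW F.L j γ ε₀ B₃ B₃' a₀ a₁).ν (stage12NumericsOfThm1CCMW F.L j γ ε₀ B₃ B₃' a₀ a₁).τ9.M
        (stage12NumericsOfThm1CCMW F.L j γ ε₀ B₃ B₃' a₀ a₁).A₁) (RzOfRecord F N) (ZtOfRecord F N) Efl logz)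
    (hjm : j + 1 ≤ F.m) (hc0 : 0 < c) (hc8 : c ≤ 8) (hγ0 : 0 < γ) (hγ : γ ≤ 1 / 2) (hε : 0 < ε₀) (hε' : 0 < ε₂₉) (hB : 0 ≤ B₃) (hB' : 0 ≤ B₃') (ha₀ : 0 < a₀) (ha₁ : 0 < a₁)
    (h15 : VariationalThm1RegSepCoP7M F N B₃ a₀ a₁) (hc₁₅ : c₁₅ ≤ F.L ^ j) (h15G : VariationalThm1GaugeRegSepCoP7MR F N (F.L ^ j) c₁₅ B₃ B₃' a₀ a₁)
    (hcomp : ∀ (p : B12.RunParams) (n : ℕ), n ≤ p.K → Step.InInterval θ.γ n (gOfRecord₁₃ F N θ p) → ∀ m, m < n →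
      θ.s2.cR * epsOfRecord θ.ν (gOfRecord₁₃ F N θ p) m ≤ 2 * (θ.s2.cR * epsOfRecord θ.ν (gOfRecord₁₃ F N θ p) (m + 1)))
    (hcompRev : ∀ (p : B12.RunParams) (n : ℕ), n ≤ p.K → Step.InInterval θ.γ n (gOfRecord₁₃ F N θ p) → ∀ m, m < n →
      θ.s2.cR * epsOfRecord θ.ν (gOfRecord₁₃ F N θ p) (m + 1) ≤ 2 * (θ.s2.cR * epsOfRecord θ.ν (gOfRecord₁₃ F N θ p) m)) :
    ∀ (p : B12.RunParams) (n : ℕ), n ≤ p.K → Step.InInterval θ.γ n (gOfRecord₁₃ F N θ p) →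
      BgProvisoΛ F N p.K (settingOfRecord₁₃ F N θ p) (θ.Rz p.K) θ.τ9.M n (suppOfRecord₁₃SepCoP F N θ p n) (UbgOfRecord₁₃CoP F N θ p n) := by
  have hnum := hnum_ccmwCRZ hθ hc0 hc8 hγ hB hB' ha₀ ha₁
  have hεreg := εreg_le_ccmwCRZ hθ
  have hBα := hBα_ccmwCRZ hθ hc0.le (by linarith) hγ hB hB' ha₀.le ha₁.le
  have htI := htI_ccmwCRZ hθ hc0.le (by linarith) hγ hB hB' ha₀.le ha₁.le
  have htMS := htMS_ccmwCRZ hθ hc0.le (by linarith) hγ hB hB' ha₀.le ha₁.le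
  have hC1 := hC1_ccmwCRZ hθ hγ
  subst hθ
  have hγ1 : γ < 1 := hγ.trans_lt (by norm_num)
  have hpos : ({ stage12NumericsOfThm1CCMW F.L j γ ε₀ B₃ B₃' a₀ a₁ with s2 := { sect2NumericsOfThm1C F.L with cR := c } } : Stage12Numerics).Pos := by
    obtain ⟨h1, h2, h3, h4, h5, h6, -, h8, h9⟩ := stage12NumericsOfThm1CCMW_pos (j := j) F.hL.2.le hγ0 hγ1 hε hB hB' ha₀ ha₁
    exact ⟨h1, h2, h3, h4, h5, h6, hc0, h8, h9⟩
  have hadm := (admissible_theta13OfNumericsZ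
    (n := ({ stage12NumericsOfThm1CCMW F.L j γ ε₀ B₃ B₃' a₀ a₁ with s2 := { sect2NumericsOfThm1C F.L with cR := c } } : Stage12Numerics)) F N
    (zeta316OfRecord F N (stage12NumericsOfThm1CCMW F.L j γ ε₀ B₃ B₃' a₀ a₁).ν (stage12NumericsOfThm1CCMW F.L j γ ε₀ B₃ B₃' a₀ a₁).τ9.M
      (stage12NumericsOfThm1CCMW F.L j γ ε₀ B₃ B₃' a₀ a₁).A₁) (RzOfRecord F N) (ZtOfRecord F N) Efl logz hpos hε').liveRepin₁₃
  exact bgProvisoΛ_of_thm1GaugeR_of_powM _ hadm rfl (show c₁₅ ≤ F.L ^ j from hc₁₅) h15 h15G hnum hεreg hcomp hcompRev hBα htI htMS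
    (hsN_theta13OfThm1CCMWZ F N γ ε₀ ε₂₉ B₃ B₃' a₀ a₁ Efl logz hjm) (a := j) rfl hC1 (show 0 < F.L ^ j from pow_pos (by have := F.hL11; omega) _)

/-- **★★★ THE `hbgs` BINDER OF dag-n11-w1's `…OfBgFacts` CONSUMERS AT EVERY H-EXTENSION OF THE z-MEMBER, FOR EVERY WINDOW `γ' ≤ θ.γ`** — per run in `]0, γ']` up to `K`, the bg facts
at EVERY length `k ≤ K`, NO run guard (window monotonicity in the length); the z-twin of dag-n11-w5 g2's p629786 §3.
[cite: Balaban1988Convergent, (2.28) p.259, Thm 1 p.262 (bookkeeping)] -/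
theorem bgFacts_ccmwCRZH_of_thm1GaugeR_of_hcomp_of_hjm {θH : Stage13HParams F N} (hH : θH.toStage13Params = θ) (hθ : θ = theta13LiveOfNumericsZ F N
      ({ stage12NumericsOfThm1CCMW F.L j γ ε₀ B₃ B₃' a₀ a₁ with s2 := { sect2NumericsOfThm1C F.L with cR := c } } : Stage12Numerics) ε₂₉
      (zeta316OfRecord F N (stage12NumericsOfThm1CCMW F.L j γ ε₀ B₃ B₃' a₀ a₁).ν (stage12NumericsOfThm1CCMW F.L j γ ε₀ B₃ B₃' a₀ a₁).τ9.M
        (stage12NumericsOfThm1CCMW F.L j γ ε₀ B₃ B₃' a₀ a₁).A₁) (RzOfRecord F N) (ZtOfRecord F N) Efl logz)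
    (hjm : j + 1 ≤ F.m) (hc0 : 0 < c) (hc8 : c ≤ 8) (hγ0 : 0 < γ) (hγ : γ ≤ 1 / 2) (hε : 0 < ε₀) (hε' : 0 < ε₂₉) (hB : 0 ≤ B₃) (hB' : 0 ≤ B₃') (ha₀ : 0 < a₀) (ha₁ : 0 < a₁)
    (h15 : VariationalThm1RegSepCoP7M F N B₃ a₀ a₁) (hc₁₅ : c₁₅ ≤ F.L ^ j) (h15G : VariationalThm1GaugeRegSepCoP7MR F N (F.L ^ j) c₁₅ B₃ B₃' a₀ a₁)
    (hcomp : ∀ (p : B12.RunParams) (n : ℕ), n ≤ p.K → Step.InInterval θ.γ n (gOfRecord₁₃ F N θ p) → ∀ m, m < n →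
      θ.s2.cR * epsOfRecord θ.ν (gOfRecord₁₃ F N θ p) m ≤ 2 * (θ.s2.cR * epsOfRecord θ.ν (gOfRecord₁₃ F N θ p) (m + 1)))
    (hcompRev : ∀ (p : B12.RunParams) (n : ℕ), n ≤ p.K → Step.InInterval θ.γ n (gOfRecord₁₃ F N θ p) → ∀ m, m < n →
      θ.s2.cR * epsOfRecord θ.ν (gOfRecord₁₃ F N θ p) (m + 1) ≤ 2 * (θ.s2.cR * epsOfRecord θ.ν (gOfRecord₁₃ F N θ p) m)) {γ' : ℝ} (hγ' : γ' ≤ θ.γ) :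
    ∀ P : B12.RunParams, Step.InInterval γ' P.K (gOfRecord₁₃ F N θH.toStage13Params P) → ∀ k, k ≤ P.K →
      BgProvisoΛ F N P.K (settingOfRecord₁₃ F N θH.toStage13Params P) (θH.Rz P.K) θH.τ9.M k (suppOfRecord₁₃SepCoP F N θH.toStage13Params P k)
        (UbgOfRecord₁₃CoP F N θH.toStage13Params P k) := by
  subst hH
  intro P hw k hk
  exact bgProvisoΛ_ccmwCRZ_of_thm1GaugeR_of_hcomp_of_hjm hθ hjm hc0 hc8 hγ0 hγ hε hε' hB hB' ha₀ ha₁ h15 hc₁₅ h15G hcomp hcompRev P k hk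
    (fun m hm => ⟨(hw m (hm.trans hk)).1, (hw m (hm.trans hk)).2.trans hγ'⟩)

end GuardFree

end Summit.QuantumFields.YangMills.Theorems.BalabanUVNodesN11K0DoorAtCRLetteredNumericsZ

end
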